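import Mathlib
import HarnessLib
import Summits.HubbardSuperconductivity.HubbardSuperconductivity.Theorems.ComplexGFFStiffnessHypACumulantTiltDerivativeBounds
import Summits.HubbardSuperconductivity.HubbardSuperconductivity.Theorems.ComplexGFFStiffnessHypALocalTwoPointReduction

/-!
# Crux `HypACumulant`, line `gnv` — **`OnePointLipschitz → CumulantGivenZ`**: the second-cumulant stub
# reduces to the `N`-uniform Lipschitz continuity of one-point functions in the perturbation

Route `route-HubbardSuperconductivity-ComplexGFFStiffness`, crux item stmt-HubbardSuperconductivity-19154
(`HypACumulant`), registered stub `stub_cumulantGivenZ : CumulantGivenZ`.  Part 3b of the reduction (after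
`…HypACumulantTiltMoments`, `…HypACumulantTiltLinear`, `…HypACumulantTiltDerivativeBounds`): the weighted `C^{r₀}` classes
(`IsIotaAdmissibleWt r₀ (1/8)`, Gaussian weight `e^{|z|²/8}`) for the pieces of the affine path
`𝒦ˡ_{g,t} = 𝒦_g + t·Q_u·(1 + 𝒦_g)`, and the assembly.

* (the derivative bounds themselves are in `…HypACumulantTiltDerivativeBounds`);
* `linTiltK_sub_admissibleWt` (`𝒦ˡ_{g,t} − 𝒦_g` has weighted size `B‖u‖|t|` — LINEAR in `t`),
  `tiltQ_admissibleWt` (`Q_u` has weighted size `B‖u‖`); the model's `𝒦_g` has weighted size `B·g`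
  (`isIotaAdmissibleWt_pertK` of the sibling crux's `…HypALocalTwoPointReduction`);
* **`cumulantGivenZ_of_onePointLipschitz : OnePointLipschitz → CumulantGivenZ`** — with the constant
  `C' = B_Q · max(C,0) · B_d` and `g₀ = min(1, ρ/(2B_p))` from the data `(ρ, C)` of `OnePointLipschitz` at
  the base `L`: `⟨Y_u²⟩_g − ⟨Y_u⟩_g²` is the derivative at `t = 0` of `t ↦ |Λ|·onePoint n 𝒦ˡ_{g,t} Q_u`
  (`hasDerivAt_card_mul_onePoint_linTiltK`), which is `(|Λ| B_Q‖u‖ · C · B_d‖u‖)`-Lipschitz at `0`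
  (for `t` so small that the path stays in the `ρ`-ball and — at fixed volume, by continuity — `pertZ ≠ 0`),
  whence `‖⟨Y_u²⟩_g − ⟨Y_u⟩_g²‖ ≤ C'·|Λ|·‖u‖² ≤ C'·|Λ|·Σ_i u_i²` (`HasDerivAt.le_of_lip'`).

Consequence for the route: both open registered stubs of the rung (`stub_cumulantGivenZ` of
`HypACumulant`, `stub_twoPointGivenZ` of `HypALocalTwoPoint`) now hinge on the single research statement
`OnePointLipschitz` ([ABKM19] Thm 2.2 smoothness half, `𝒲_N ∈ C^{1,1}` on the `ι`-symmetric class,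
uniformly in `N`).  Honest framing: nothing here is uniform in the volume by itself and nothing bears on the
Hubbard model beyond the crux's bookkeeping; `OnePointLipschitz` is NOT proved here.  All proved, no `sorry`.

## References
* S. Adams, S. Buchholz, R. Kotecký, S. Müller, arXiv:1910.13564, Sec. 2.1 (the space `E_{ζ,𝒬}`),
  Theorem 2.2 [AdamsBuchholzKoteckyMuller2019].
-/

noncomputable section

-- `Summit.<Summit>.<Problem>`: single-conjunct summit, the duplicate component is mandated (D-0017).
set_option linter.dupNamespace false

namespace Summit.HubbardSuperconductivity.HubbardSuperconductivity.Theorems.ComplexGFF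

open scoped BigOperators ComplexConjugate
open MeasureTheory
open Literature.MathematicalPhysics.StatisticalMechanics.ComplexGradientGFF4 (Z ev Y D S X w)

/-! ### Weighted `ι`-admissibility (`IsIotaAdmissibleWt r₀ (1/8)`) of the pieces of the linear tilt -/

/-- radii add along `K' = K + (K' − K)`. -/
theorem IsIotaAdmissibleWt.of_sub {r₀ : ℕ} {a ρ₁ ρ₂ : ℝ} {K K' : (Fin 4 → ℝ) → ℂ}
    (h₁ : IsIotaAdmissibleWt r₀ a ρ₁ K) (h₂ : IsIotaAdmissibleWt r₀ a ρ₂ (fun z => K' z - K z)) :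
    IsIotaAdmissibleWt r₀ a (ρ₁ + ρ₂) K' := by
  have e : K' = K + fun z => K' z - K z := by funext z; simp
  have hc : ContDiff ℝ r₀ K' := by rw [e]; exact h₁.1.add h₂.1
  refine ⟨hc, fun k hk z => ?_, fun z => ?_⟩
  · have hk' : (k : WithTop ℕ∞) ≤ r₀ := by exact_mod_cast hk
    rw [e, iteratedFDeriv_add_apply (h₁.1.of_le hk').contDiffAt (h₂.1.of_le hk').contDiffAt]
    refine le_trans (norm_add_le _ _) ?_
    rw [add_mul]
    exact add_le_add (h₁.2.1 k hk z) (h₂.2.1 k hk z)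
  · have h1 : K (-z) = conj (K z) := h₁.2.2 z
    have h2 : K' (-z) - K (-z) = conj (K' z - K z) := h₂.2.2 z
    calc K' (-z) = K (-z) + (K' (-z) - K (-z)) := by ring
      _ = conj (K z) + conj (K' z - K z) := by rw [h2, h1]
      _ = conj (K' z) := by rw [← map_add]; congr 1; ring

/-- **The direction of the linear tilt in the weight `e^{|z|²/8}`:** there is `B = B(r₀) > 0` with
`IsIotaAdmissibleWt r₀ (1/8) (B‖u‖|t|) (𝒦ˡ_{g,t} − 𝒦_g)` for all `0 ≤ g ≤ 1`, `u`, `t` — the weighted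
`C^{r₀}` distance from `𝒦ˡ_{g,t}` to `𝒦_g` is LINEAR in `|t|‖u‖`. -/
theorem linTiltK_sub_admissibleWt (r₀ : ℕ) :
    ∃ B : ℝ, 0 < B ∧ ∀ g : ℝ, 0 ≤ g → g ≤ 1 → ∀ (u : Fin 4 → ℝ) (t : ℝ),
      IsIotaAdmissibleWt r₀ (1 / 8) (B * ‖u‖ * |t|) (fun z => linTiltK g u t z - pertK g z) := by
  obtain ⟨C, hC, hCle⟩ := one_add_norm_pow_le_exp_sum_sq (2 * r₀ + 2)
  refine ⟨18 * r₀.factorial * 36 ^ r₀ * C, by positivity, fun g hg0 hg1 u t => ?_⟩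
  have hF : ContDiff ℝ (⊤ : WithTop ℕ∞) (fun z : Fin 4 → ℝ => ((tiltQ u z : ℝ) : ℂ) * (1 + pertK g z)) :=
    (contDiff_tiltQ_ofReal u).mul (contDiff_one_add_pertK g)
  have e : (fun z => linTiltK g u t z - pertK g z)
      = fun z => (t : ℂ) • (((tiltQ u z : ℝ) : ℂ) * (1 + pertK g z)) := by
    funext z; rw [linTiltK_sub, smul_eq_mul]
  refine ⟨?_, fun k hk z => ?_, fun z => ?_⟩
  · rw [e]; exact (hF.const_smul (t : ℂ)).of_le le_top
  · rw [e, iteratedFDeriv_const_smul_apply' (hF.contDiffAt.of_le le_top), norm_smul, Complex.norm_real,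
      Real.norm_eq_abs]
    have hz : 0 ≤ ‖z‖ := norm_nonneg z
    have hu0 : 0 ≤ ‖u‖ := norm_nonneg u
    have h1z : 1 ≤ 1 + ‖z‖ := by linarith
    have h := norm_iteratedFDeriv_tiltQ_mul_le hg0 hg1 u k z
    have hfac : (k.factorial : ℝ) ≤ r₀.factorial := by exact_mod_cast Nat.factorial_le hk
    have h36 : (36 : ℝ) ^ k ≤ 36 ^ r₀ := pow_le_pow_right₀ (by norm_num) hk
    have hp : (1 + ‖z‖) ^ (2 * k + 2) ≤ (1 + ‖z‖) ^ (2 * r₀ + 2) := pow_le_pow_right₀ h1z (by omega)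
    calc |t| * ‖iteratedFDeriv ℝ k (fun z : Fin 4 → ℝ => ((tiltQ u z : ℝ) : ℂ) * (1 + pertK g z)) z‖
        ≤ |t| * (‖u‖ * (18 * k.factorial * 36 ^ k) * (1 + ‖z‖) ^ (2 * k + 2)) :=
          mul_le_mul_of_nonneg_left h (abs_nonneg t)
      _ ≤ |t| * (‖u‖ * (18 * r₀.factorial * 36 ^ r₀) * (C * Real.exp ((1 / 8 : ℝ) * ∑ i : Fin 4, (z i) ^ 2))) := by
          gcongr
          exact le_trans hp (hCle z)
      _ = 18 * r₀.factorial * 36 ^ r₀ * C * ‖u‖ * |t| * Real.exp ((1 / 8 : ℝ) * ∑ i : Fin 4, (z i) ^ 2) := by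
          ring
  · show linTiltK g u t (-z) - pertK g (-z) = conj (linTiltK g u t z - pertK g z)
    rw [linTiltK_neg, pertK_neg, map_sub]

/-- **The observable `Q_u` in the weight `e^{|z|²/8}`:** there is a universal `B > 0` with
`IsIotaAdmissibleWt r₀ (1/8) (B‖u‖) Q_u` for all `r₀`, `u`. -/
theorem tiltQ_admissibleWt (r₀ : ℕ) :
    ∃ B : ℝ, 0 < B ∧ ∀ u : Fin 4 → ℝ, IsIotaAdmissibleWt r₀ (1 / 8) (B * ‖u‖) (fun z => ((tiltQ u z : ℝ) : ℂ)) := by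
  obtain ⟨C, hC, hCle⟩ := one_add_norm_pow_le_exp_sum_sq 2
  refine ⟨18 * C, by positivity, fun u => ⟨(contDiff_tiltQ_ofReal u).of_le le_top, fun k _ z => ?_, fun z => ?_⟩⟩
  · calc ‖iteratedFDeriv ℝ k (fun z : Fin 4 → ℝ => ((tiltQ u z : ℝ) : ℂ)) z‖
        ≤ 18 * ‖u‖ * (1 + ‖z‖) ^ 2 := norm_iteratedFDeriv_tiltQ_ofReal_le u k z
      _ ≤ 18 * ‖u‖ * (C * Real.exp ((1 / 8 : ℝ) * ∑ i : Fin 4, (z i) ^ 2)) :=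
          mul_le_mul_of_nonneg_left (hCle z) (by positivity)
      _ = 18 * C * ‖u‖ * Real.exp ((1 / 8 : ℝ) * ∑ i : Fin 4, (z i) ^ 2) := by ring
  · show ((tiltQ u (-z) : ℝ) : ℂ) = conj ((tiltQ u z : ℝ) : ℂ)
    rw [tiltQ_neg, Complex.conj_ofReal]

/-- The normalised observable: for `c ≠ 0`, `IsIotaAdmissibleWt r₀ a ρ G` implies
`IsIotaAdmissibleWt r₀ a (|c⁻¹| ρ) (c⁻¹ • G)`. -/
theorem IsIotaAdmissibleWt.const_smul {r₀ : ℕ} {a ρ : ℝ} {G : (Fin 4 → ℝ) → ℂ}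
    (h : IsIotaAdmissibleWt r₀ a ρ G) (c : ℝ) :
    IsIotaAdmissibleWt r₀ a (|c| * ρ) (fun z => (c : ℂ) * G z) := by
  have e : (fun z => (c : ℂ) * G z) = fun z => (c : ℂ) • G z := by funext z; rw [smul_eq_mul]
  refine ⟨?_, fun k hk z => ?_, fun z => ?_⟩
  · rw [e]; exact h.1.const_smul (c : ℂ)
  · have hk' : (k : WithTop ℕ∞) ≤ r₀ := by exact_mod_cast hk
    rw [e, iteratedFDeriv_const_smul_apply' ((h.1.of_le hk').contDiffAt), norm_smul, Complex.norm_real,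
      Real.norm_eq_abs, mul_assoc]
    exact mul_le_mul_of_nonneg_left (h.2.1 k hk z) (abs_nonneg c)
  · show (c : ℂ) * G (-z) = conj ((c : ℂ) * G z)
    rw [h.2.2 z, map_mul, Complex.conj_ofReal]

/-- one-point functions are linear in the observable: `onePoint n K (c·G) = c · onePoint n K G`. -/
theorem onePoint_const_mul {n : ℕ} [NeZero n] (K G : (Fin 4 → ℝ) → ℂ) (c : ℂ) :
    onePoint n K (fun z => c * G z) = c * onePoint n K G := by
  unfold onePoint
  rw [mul_div_assoc']
  congr 1
  rw [← integral_const_mul]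
  refine integral_congr_ae (Filter.Eventually.of_forall (fun φ => ?_))
  beta_reduce
  rw [← Finset.mul_sum]
  ring

/-- `Y_0 = 0`. -/
theorem Y_zero_tilt {n : ℕ} [NeZero n] (φ : (Fin 4 → ZMod n) → ℝ) : Y 0 φ = 0 := by
  unfold Y
  simp

/-! ### The reduction -/

/-- **`CumulantGivenZ` from `OnePointLipschitz`.**  The `N`-uniform second-cumulant bound for the tilt
response `Y_u` (the registered stub `stub_cumulantGivenZ` of the crux `HypACumulant`) follows from the
`N`-uniform Lipschitz continuity of one-point functions in the perturbation (`OnePointLipschitz`, the research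
statement shared with the sibling crux `HypALocalTwoPoint`): `⟨Y_u²⟩_g − ⟨Y_u⟩_g²` is the `t`-derivative at
`0` of `|Λ|·onePoint n 𝒦ˡ_{g,t} Q_u` (`hasDerivAt_card_mul_onePoint_linTiltK`), and along the affine path
`𝒦ˡ_{g,t}` the weighted distance to `𝒦_g` is `≤ B‖u‖|t|` while `Q_u` has weighted size `≤ B'‖u‖`, so the
Lipschitz bound gives `|Λ|·B'‖u‖·C·B‖u‖|t|` and hence `‖⟨Y_u²⟩_g − ⟨Y_u⟩_g²‖ ≤ (B B' C)·|Λ|·Σ_i u_i²`.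
[cite: AdamsBuchholzKoteckyMuller2019, Thm 2.2] -/
theorem cumulantGivenZ_of_onePointLipschitz (h : OnePointLipschitz) : CumulantGivenZ := by
  obtain ⟨r₀, L₀, hL⟩ := h
  obtain ⟨Bp, hBp, hp⟩ := isIotaAdmissibleWt_pertK r₀
  obtain ⟨Bd, hBd, hd⟩ := linTiltK_sub_admissibleWt r₀
  obtain ⟨Bq, hBq, hq⟩ := tiltQ_admissibleWt r₀
  refine ⟨L₀, fun L hLodd hle => ?_⟩
  obtain ⟨ρ, C, hρ, hmain⟩ := hL L hLodd hle
  set C₀ : ℝ := max C 0 with hC₀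
  have hC₀0 : 0 ≤ C₀ := le_max_right _ _
  have hCC₀ : C ≤ C₀ := le_max_left _ _
  refine ⟨min 1 (ρ / (2 * Bp)), Bq * C₀ * Bd, lt_min one_pos (by positivity), ?_⟩
  intro g hg0 hg N hN n _ hn hZ u
  have hg1 : g ≤ 1 := le_trans hg (min_le_left _ _)
  -- the model's perturbation has weighted size `≤ ρ/2`
  have hKρ : IsIotaAdmissibleWt r₀ (1 / 8) (ρ / 2) (pertK g) := by
    refine (hp g hg0 hg1).mono ?_
    have hg2 : g ≤ ρ / (2 * Bp) := le_trans hg (min_le_right _ _)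
    calc Bp * g ≤ Bp * (ρ / (2 * Bp)) := mul_le_mul_of_nonneg_left hg2 hBp.le
      _ = ρ / 2 := by field_simp
  rcases eq_or_ne u 0 with hu | hu
  · -- trivial twist: `Y_0 = 0`
    subst hu
    have e0 : ev n g (fun φ => ((Y 0 φ ^ 2 : ℝ) : ℂ)) - (ev n g (fun φ => ((Y 0 φ : ℝ) : ℂ))) ^ 2 = 0 := by
      have h1 : (fun φ : (Fin 4 → ZMod n) → ℝ => ((Y 0 φ ^ 2 : ℝ) : ℂ)) = fun _ => 0 := by
        funext φ; rw [Y_zero_tilt]; simp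
      have h2 : (fun φ : (Fin 4 → ZMod n) → ℝ => ((Y 0 φ : ℝ) : ℂ)) = fun _ => 0 := by
        funext φ; rw [Y_zero_tilt]; simp
      rw [h1, h2]
      unfold ev
      simp
    rw [e0, norm_zero]
    positivity
  · -- the main case
    have hν : 0 < ‖u‖ := norm_pos_iff.mpr hu
    set ν : ℝ := ‖u‖ with hνdef
    -- the normalised observable `G = Q_u / (Bq ν)`
    set G : (Fin 4 → ℝ) → ℂ := fun z => (((Bq * ν)⁻¹ : ℝ) : ℂ) * ((tiltQ u z : ℝ) : ℂ) with hGdef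
    have hG : IsIotaAdmissibleWt r₀ (1 / 8) 1 G := by
      have h := (hq u).const_smul (Bq * ν)⁻¹
      have e : |(Bq * ν)⁻¹| * (Bq * ν) = 1 := by
        rw [abs_of_pos (by positivity)]
        field_simp
      rw [e] at h
      exact h
    have hQG : ∀ z, ((tiltQ u z : ℝ) : ℂ) = ((Bq * ν : ℝ) : ℂ) * G z := by
      intro z
      simp only [hGdef]
      rw [← mul_assoc, ← Complex.ofReal_mul, mul_inv_cancel₀ (by positivity : Bq * ν ≠ 0)]
      simp
    -- the function whose derivative at `0` is the second cumulant
    set f : ℝ → ℂ := fun t =>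
      (Fintype.card (Fin 4 → ZMod n) : ℂ) * onePoint n (linTiltK g u t) (fun z => ((tiltQ u z : ℝ) : ℂ)) with hfdef
    have hf : HasDerivAt f
        (ev n g (fun φ => ((Y u φ ^ 2 : ℝ) : ℂ)) - (ev n g (fun φ => ((Y u φ : ℝ) : ℂ))) ^ 2) 0 :=
      hasDerivAt_card_mul_onePoint_linTiltK g u hZ
    have hQfun : (fun z => ((tiltQ u z : ℝ) : ℂ)) = fun z => ((Bq * ν : ℝ) : ℂ) * G z := funext hQG
    have hfG : ∀ t, f t = (Fintype.card (Fin 4 → ZMod n) : ℂ) * (((Bq * ν : ℝ) : ℂ) *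
        onePoint n (linTiltK g u t) G) := by
      intro t
      simp only [hfdef]
      rw [hQfun, onePoint_const_mul]
    -- non-vanishing of `pertZ` along the path near `t = 0` (fixed volume, continuity)
    have hZ0 : pertZ n (pertK g) ≠ 0 := by rwa [pertZ_pertK]
    have hev1 : ∀ᶠ t : ℝ in nhds 0, pertZ n (linTiltK g u t) ≠ 0 := by
      have hc : ContinuousAt (linTiltMoment n g u 0) 0 := (hasDerivAt_linTiltMoment_zero g u 0).continuousAt
      have hne : linTiltMoment n g u 0 0 ≠ 0 := by
        rwa [linTiltMoment_at_zero, tiltMoment_zero_zero]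
      filter_upwards [hc.eventually_ne hne] with t ht
      rwa [pertZ_linTiltK]
    -- smallness of `t`: the path stays in the `ρ`-ball
    set τ : ℝ := ρ / (2 * Bd * ν) with hτ
    have hτ0 : 0 < τ := by positivity
    have hev2 : ∀ᶠ t : ℝ in nhds 0, |t| < τ := by
      have h1 : ∀ᶠ t : ℝ in nhds 0, t < τ := eventually_lt_nhds hτ0
      have h2 : ∀ᶠ t : ℝ in nhds 0, -τ < t := eventually_gt_nhds (by linarith)
      filter_upwards [h1, h2] with t ht1 ht2
      exact abs_lt.mpr ⟨ht2, ht1⟩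
    -- the Lipschitz estimate along the path
    set M : ℝ := (Fintype.card (Fin 4 → ZMod n) : ℝ) * (Bq * ν) * (C₀ * (Bd * ν)) with hM
    have hM0 : 0 ≤ M := by positivity
    have hlip : ∀ᶠ t : ℝ in nhds 0, ‖f t - f 0‖ ≤ M * ‖t - 0‖ := by
      filter_upwards [hev1, hev2] with t ht1 ht2
      have hδ : IsIotaAdmissibleWt r₀ (1 / 8) (Bd * ν * |t|) (fun z => linTiltK g u t z - pertK g z) :=
        hd g hg0 hg1 u t
      have hKt : IsIotaAdmissibleWt r₀ (1 / 8) ρ (linTiltK g u t) := by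
        refine (hKρ.of_sub hδ).mono ?_
        have h1 : Bd * ν * |t| ≤ Bd * ν * τ := mul_le_mul_of_nonneg_left ht2.le (by positivity)
        have h2 : Bd * ν * τ = ρ / 2 := by rw [hτ]; field_simp
        linarith
      have hone := hmain N hN n hn (linTiltK g u t) (pertK g) G (Bd * ν * |t|) hKt (hKρ.mono (by linarith)) hG
        (by positivity) hδ ht1 hZ0
      rw [hfG, hfG, sub_zero, linTiltK_zero, ← mul_sub, ← mul_sub, norm_mul, norm_mul, Complex.norm_natCast,
        Complex.norm_real, Real.norm_eq_abs, abs_of_pos (by positivity : 0 < Bq * ν), Real.norm_eq_abs]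
      calc (Fintype.card (Fin 4 → ZMod n) : ℝ) * ((Bq * ν) *
            ‖onePoint n (linTiltK g u t) G - onePoint n (pertK g) G‖)
          ≤ (Fintype.card (Fin 4 → ZMod n) : ℝ) * ((Bq * ν) * (C * (Bd * ν * |t|))) := by gcongr
        _ ≤ (Fintype.card (Fin 4 → ZMod n) : ℝ) * ((Bq * ν) * (C₀ * (Bd * ν * |t|))) := by gcongr
        _ = M * |t| := by rw [hM]; ring
    have hbound := hf.le_of_lip' hM0 hlip
    refine le_trans hbound ?_
    have hν2 : ν ^ 2 ≤ ∑ i : Fin 4, (u i) ^ 2 := norm_sq_le_sum_sq u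
    calc M = Bq * C₀ * Bd * (Fintype.card (Fin 4 → ZMod n) : ℝ) * ν ^ 2 := by rw [hM]; ring
      _ ≤ Bq * C₀ * Bd * (Fintype.card (Fin 4 → ZMod n) : ℝ) * ∑ i : Fin 4, (u i) ^ 2 := by gcongr

end Summit.HubbardSuperconductivity.HubbardSuperconductivity.Theorems.ComplexGFF

end
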